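import Literature.Probability.RandomPlanarGeometry.ObliqueRBMWedgeSkorokhod
import Literature.Probability.Process.BrownianRunningSup
import HarnessLib

/-!
# The Skorokhod reflection map: continuity, flow property, countable (dyadic) supremum

Second deterministic layer of the proof of
`Literature.Probability.RandomPlanarGeometry.LawlerSchrammWerner2001_orbm_uniformHitting`
(`ObliqueRBMWedge.lean`), continuing `ObliqueRBMWedgeSkorokhod.lean` (the boundary term
`skorokhodBdry b t = sup_{s ≤ t} max 0 (−b s)` and Skorokhod's uniqueness lemma). Here:

* `continuous_skorokhodBdry` — for a continuous path `b`, `t ↦ skorokhodBdry b t` is continuous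
  (its increment over `[s, t]` is at most the oscillation of `b` there,
  `skorokhodBdry_le_add_of_forall_sub_le`);
* `skorokhodBdry_add` — the **flow (cocycle) property** of the reflection map: with
  `x = b + skorokhodBdry b` the reflected path,
  `skorokhodBdry b (s + h) = skorokhodBdry b s + skorokhodBdry (u ↦ x s + (b (s + u) − b s)) h`,
  i.e. after time `s` the reflected path is the reflection, started from its current value `x s`,
  of the increments of `b` (this is what makes the reflected Brownian motion Markov);
* `skorokhodBdryDyad b t = ⨆ (n, k), max 0 (−b (dyadTime t n k))` — the same supremum over the
  countable dyadic grid of `[0, t]` (`Process.dyadTime`), hence MEASURABLE in the path for a process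
  with measurable marginals (`measurable_skorokhodBdryDyad`), and equal to `skorokhodBdry b t` on
  continuous paths (`skorokhodBdryDyad_eq`).

All statements are deterministic path-by-path facts (no probability).

## References

* A. V. Skorokhod (1961); D. Revuz, M. Yor, *Continuous Martingales and Brownian Motion* (1999),
  Ch. VI §2 (Lemma (2.1) and the discussion of the reflection map).
* W. Werner, LNM 1840 (2004), Ch. 5 §5.1. [WernerStFlour2004]
-/

noncomputable section

open MeasureTheory Set Filter
open scoped NNReal Topology

namespace Literature.Probability.RandomPlanarGeometry

open Literature.Probability.Process

variable {b : ℝ≥0 → ℝ}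

/-! ### Continuity of the boundary term -/

/-- If `b s − b r ≤ ε` for all `r ∈ [s, t]` then `skorokhodBdry b t ≤ skorokhodBdry b s + ε`:
the boundary term grows over `[s, t]` by at most the downward oscillation of `b`. [folklore] -/
theorem skorokhodBdry_le_add_of_forall_sub_le (hb : Continuous b) {s t : ℝ≥0} (hst : s ≤ t)
    {ε : ℝ} (hε : ∀ r ∈ Icc s t, b s - b r ≤ ε) :
    skorokhodBdry b t ≤ skorokhodBdry b s + ε := by
  have hε0 : 0 ≤ ε := by simpa using hε s ⟨le_rfl, hst⟩
  rw [skorokhodBdry_le_iff hb]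
  intro r hr
  by_cases hrs : r ≤ s
  · exact (le_skorokhodBdry hb hrs).trans (le_add_of_nonneg_right hε0)
  · have hr' : r ∈ Icc s t := ⟨(not_le.1 hrs).le, hr⟩
    refine max_le (add_nonneg (skorokhodBdry_nonneg hb s) hε0) ?_
    have h1 := neg_le_skorokhodBdry hb (le_refl s)
    have h2 := hε r hr'
    linarith

/-- In `ℝ≥0`, for `r ∈ [s, t]` one has `dist r s ≤ dist t s`. [folklore] -/
theorem dist_le_dist_of_mem_Icc {s t r : ℝ≥0} (hr : r ∈ Icc s t) : dist r s ≤ dist t s := by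
  rw [NNReal.dist_eq, NNReal.dist_eq, abs_of_nonneg (by simpa using hr.1),
    abs_of_nonneg (by simpa using hr.1.trans hr.2)]
  exact sub_le_sub_right (by exact_mod_cast hr.2) _

/-- **The boundary term of a continuous path is continuous in time.** [folklore] -/
theorem continuous_skorokhodBdry (hb : Continuous b) : Continuous (skorokhodBdry b) := by
  rw [Metric.continuous_iff]
  intro s ε hε
  obtain ⟨δ, hδ, hδb⟩ := Metric.continuous_iff.1 hb s (ε / 3) (by positivity)
  refine ⟨δ, hδ, fun t hts ↦ ?_⟩
  have hmono := skorokhodBdry_mono hb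
  rcases le_total s t with hst | hts'
  · -- `s ≤ t`: `g s ≤ g t ≤ g s + ε/3`
    have hup : skorokhodBdry b t ≤ skorokhodBdry b s + ε / 3 := by
      refine skorokhodBdry_le_add_of_forall_sub_le hb hst fun r hr ↦ ?_
      have := hδb r ((dist_le_dist_of_mem_Icc hr).trans_lt hts)
      rw [Real.dist_eq] at this
      linarith [(abs_lt.1 this).1]
    rw [Real.dist_eq, abs_lt]
    constructor <;> linarith [hmono hst]
  · -- `t ≤ s`: `g t ≤ g s ≤ g t + 2ε/3`
    have hup : skorokhodBdry b s ≤ skorokhodBdry b t + 2 * ε / 3 := by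
      refine skorokhodBdry_le_add_of_forall_sub_le hb hts' fun r hr ↦ ?_
      have hrt : dist r s < δ := by
        have : dist r s ≤ dist t s := by
          rw [NNReal.dist_eq, NNReal.dist_eq, abs_sub_comm, abs_of_nonneg (by simpa using hr.2),
            abs_sub_comm, abs_of_nonneg (by simpa using hts')]
          exact sub_le_sub_left (by exact_mod_cast hr.1) _
        exact this.trans_lt hts
      have h1 := hδb r hrt
      have h2 := hδb t hts
      rw [Real.dist_eq] at h1 h2
      linarith [(abs_lt.1 h1).1, (abs_lt.1 h1).2, (abs_lt.1 h2).1, (abs_lt.1 h2).2]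
    rw [Real.dist_eq, abs_lt]
    constructor <;> linarith [hmono hts']

/-! ### The flow (cocycle) property -/

/-- **Flow property of the Skorokhod reflection map.** For a continuous path `b` and times
`s, h`, with `x = b + skorokhodBdry b` the reflected path,
`skorokhodBdry b (s + h) = skorokhodBdry b s + skorokhodBdry (u ↦ x s + (b (s + u) − b s)) h`:
the boundary term accumulated on `[s, s + h]` is that of the increment path restarted from the
current position `x s ≥ 0`. (Revuz–Yor (1999), Ch. VI §2.) [folklore] -/
theorem skorokhodBdry_add (hb : Continuous b) (s h : ℝ≥0) :
    skorokhodBdry b (s + h) = skorokhodBdry b s +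
      skorokhodBdry (fun u ↦ (b s + skorokhodBdry b s) + (b (s + u) - b s)) h := by
  set g := skorokhodBdry b with hg
  have hc : Continuous fun u ↦ (b s + g s) + (b (s + u) - b s) := by
    have : Continuous fun u : ℝ≥0 ↦ b (s + u) := hb.comp (continuous_const.add continuous_id)
    fun_prop
  have hgs : 0 ≤ g s := skorokhodBdry_nonneg hb s
  refine le_antisymm ?_ ?_
  · rw [hg, skorokhodBdry_le_iff hb]
    intro r hr
    by_cases hrs : r ≤ s
    · exact (le_skorokhodBdry hb hrs).trans (le_add_of_nonneg_right (skorokhodBdry_nonneg hc h))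
    · -- `r = s + u` with `u ≤ h`
      obtain ⟨u, rfl⟩ : ∃ u, r = s + u := ⟨r - s, by
        rw [add_tsub_cancel_of_le (not_le.1 hrs).le]⟩
      have hu : u ≤ h := by
        have : s + u ≤ s + h := hr
        exact le_of_add_le_add_left this
      have h1 := le_skorokhodBdry hc hu
      -- `max 0 (-(b s + g s + (b (s+u) - b s))) = max 0 (-b (s+u) - g s)`
      have h2 : max 0 (-b (s + u)) ≤ g s + max 0 (-((b s + g s) + (b (s + u) - b s))) := by
        rw [show -((b s + g s) + (b (s + u) - b s)) = -b (s + u) - g s by ring]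
        rcases le_total 0 (-b (s + u) - g s) with h0 | h0
        · rw [max_eq_right h0]
          refine max_le (by linarith) (by linarith)
        · rw [max_eq_left h0]
          refine max_le (by linarith) (by linarith)
      exact h2.trans (add_le_add le_rfl h1)
  · -- `g s + sup_{u ≤ h} max 0 (-b (s+u) - g s) ≤ g (s + h)`
    suffices hsuf : skorokhodBdry (fun u ↦ (b s + g s) + (b (s + u) - b s)) h ≤ g (s + h) - g s by
      linarith
    rw [skorokhodBdry_le_iff hc]
    intro u hu
    rw [show -((b s + g s) + (b (s + u) - b s)) = -b (s + u) - g s by ring]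
    have h1 : g s ≤ g (s + h) := skorokhodBdry_mono hb (le_add_of_nonneg_right bot_le)
    have h2 : -b (s + u) ≤ g (s + h) := neg_le_skorokhodBdry hb (add_le_add le_rfl hu)
    exact max_le (by linarith) (by linarith)

/-- The flow property for the reflected path `x = b + skorokhodBdry b` itself:
`x (s + h) = c h + skorokhodBdry c h` with `c u = x s + (b (s + u) − b s)` the increment path
restarted from `x s`. [folklore] -/
theorem skorokhod_reflected_add (hb : Continuous b) (s h : ℝ≥0) :
    b (s + h) + skorokhodBdry b (s + h) =
      ((b s + skorokhodBdry b s) + (b (s + h) - b s)) +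
        skorokhodBdry (fun u ↦ (b s + skorokhodBdry b s) + (b (s + u) - b s)) h := by
  rw [skorokhodBdry_add hb s h]
  ring

/-! ### The boundary term as a countable supremum -/

/-- The boundary term as a supremum over the countable dyadic grid
`{(k t / 2ⁿ) ∧ t : n, k ∈ ℕ}` of `[0, t]` (`Process.dyadTime`); measurable in the path, and equal
to `skorokhodBdry b t` for continuous `b` (`skorokhodBdryDyad_eq`). [folklore] -/
def skorokhodBdryDyad (b : ℝ≥0 → ℝ) (t : ℝ≥0) : ℝ :=
  ⨆ p : ℕ × ℕ, max 0 (-b (dyadTime t p.1 p.2))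

/-- The dyadic family is bounded above by `skorokhodBdry b t` (continuous `b`). [folklore] -/
theorem bddAbove_range_skorokhod_dyad (hb : Continuous b) (t : ℝ≥0) :
    BddAbove (range fun p : ℕ × ℕ ↦ max 0 (-b (dyadTime t p.1 p.2))) := by
  refine ⟨skorokhodBdry b t, ?_⟩
  rintro _ ⟨p, rfl⟩
  exact le_skorokhodBdry hb (dyadTime_le t p.1 p.2)

/-- `skorokhodBdryDyad b t ≤ skorokhodBdry b t` (continuous `b`). [folklore] -/
theorem skorokhodBdryDyad_le (hb : Continuous b) (t : ℝ≥0) :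
    skorokhodBdryDyad b t ≤ skorokhodBdry b t :=
  ciSup_le fun p ↦ le_skorokhodBdry hb (dyadTime_le t p.1 p.2)

/-- **Dyadic approximation from below**: for `s ≤ t` there are grid indices `k n` with
`dyadTime t n (k n) → s`. [folklore] -/
theorem exists_tendsto_dyadTime {t s : ℝ≥0} (hs : s ≤ t) (ht : t ≠ 0) :
    ∃ k : ℕ → ℕ, Tendsto (fun n ↦ dyadTime t n (k n)) atTop (𝓝 s) := by
  have hpos : (0 : ℝ) < t := lt_of_le_of_ne t.coe_nonneg (fun h' ↦ ht (by exact_mod_cast h'.symm))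
  set k : ℕ → ℕ := fun n ↦ ⌊(s : ℝ) / t * 2 ^ n⌋₊ with hk
  refine ⟨k, ?_⟩
  have hbounds : ∀ n, (dyadTime t n (k n) : ℝ) ≤ s ∧ (s : ℝ) - t / 2 ^ n ≤ dyadTime t n (k n) := by
    intro n
    have hfl := Nat.floor_le (by positivity : (0 : ℝ) ≤ (s : ℝ) / t * 2 ^ n)
    have hfl' : (s : ℝ) / t * 2 ^ n < k n + 1 := Nat.lt_floor_add_one _
    have hval : ((t * ((k n : ℝ≥0) / 2 ^ n) : ℝ≥0) : ℝ) = t * (k n : ℝ) / 2 ^ n := by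
      push_cast; ring
    have hle : ((t * ((k n : ℝ≥0) / 2 ^ n) : ℝ≥0) : ℝ) ≤ s := by
      rw [hval, div_le_iff₀ (by positivity)]
      calc (t : ℝ) * (k n) ≤ t * ((s : ℝ) / t * 2 ^ n) :=
            mul_le_mul_of_nonneg_left hfl t.coe_nonneg
        _ = s * 2 ^ n := by field_simp
    have hmin : dyadTime t n (k n) = t * ((k n : ℝ≥0) / 2 ^ n) := by
      rw [dyadTime, min_eq_left]
      exact_mod_cast hle.trans (by exact_mod_cast hs : (s : ℝ) ≤ t)
    refine ⟨by rw [hmin]; exact hle, ?_⟩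
    rw [hmin, hval, le_div_iff₀ (by positivity)]
    rw [div_mul_eq_mul_div, div_lt_iff₀ hpos] at hfl'
    have : ((s : ℝ) - t / 2 ^ n) * 2 ^ n = s * 2 ^ n - t := by field_simp
    rw [this]
    nlinarith
  have hconv : Tendsto (fun n ↦ (dyadTime t n (k n) : ℝ)) atTop (𝓝 s) := by
    refine tendsto_of_tendsto_of_tendsto_of_le_of_le ?_ tendsto_const_nhds (fun n ↦ (hbounds n).2)
      (fun n ↦ (hbounds n).1)
    have h1 : Tendsto (fun n : ℕ ↦ (t : ℝ) / 2 ^ n) atTop (𝓝 0) := by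
      have := (tendsto_pow_atTop_nhds_zero_of_lt_one (r := (1 / 2 : ℝ)) (by norm_num)
        (by norm_num)).const_mul (t : ℝ)
      rw [mul_zero] at this
      refine this.congr fun n ↦ ?_
      rw [one_div, inv_pow, div_eq_mul_inv]
    simpa using tendsto_const_nhds.sub h1
  exact NNReal.tendsto_coe.1 hconv

/-- A continuous function on `[0, t]` is dominated by its supremum over the dyadic grid: if
`g (dyadTime t n k) ≤ c` for all `n, k` then `g s ≤ c` for all `s ≤ t`. [folklore] -/
theorem le_of_forall_dyadTime_le {g : ℝ≥0 → ℝ} (hg : Continuous g) {t : ℝ≥0} {c : ℝ}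
    (hc : ∀ n k, g (dyadTime t n k) ≤ c) {s : ℝ≥0} (hs : s ≤ t) : g s ≤ c := by
  rcases eq_or_ne t 0 with rfl | ht
  · have : s = 0 := le_antisymm hs bot_le
    subst this
    have := hc 0 0
    simpa [dyadTime] using this
  obtain ⟨k, hk⟩ := exists_tendsto_dyadTime hs ht
  exact le_of_tendsto' ((hg.tendsto s).comp hk) fun n ↦ hc n (k n)

/-- **On continuous paths the dyadic supremum is the boundary term.** [folklore] -/
theorem skorokhodBdryDyad_eq (hb : Continuous b) (t : ℝ≥0) :
    skorokhodBdryDyad b t = skorokhodBdry b t := by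
  refine le_antisymm (skorokhodBdryDyad_le hb t) ?_
  rw [skorokhodBdry_le_iff hb]
  intro s hs
  have hg : Continuous fun r ↦ max 0 (-b r) := by fun_prop
  exact le_of_forall_dyadTime_le hg
    (fun n k ↦ le_ciSup (bddAbove_range_skorokhod_dyad hb t) (n, k)) hs

/-- **Measurability of the boundary term of a process**: if every marginal `ω ↦ X s ω` is
measurable then so is `ω ↦ skorokhodBdryDyad (X · ω) t`. [folklore] -/
theorem measurable_skorokhodBdryDyad {Ω : Type*} [MeasurableSpace Ω] {X : ℝ≥0 → Ω → ℝ}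
    (hX : ∀ s, Measurable (X s)) (t : ℝ≥0) :
    Measurable fun ω ↦ skorokhodBdryDyad (X · ω) t :=
  Measurable.iSup fun _ ↦ measurable_const.max (hX _).neg

/-- Measurability of the boundary term of a process with continuous paths and measurable
marginals. [folklore] -/
theorem measurable_skorokhodBdry {Ω : Type*} [MeasurableSpace Ω] {X : ℝ≥0 → Ω → ℝ}
    (hX : ∀ s, Measurable (X s)) (hc : ∀ ω, Continuous (X · ω)) (t : ℝ≥0) :
    Measurable fun ω ↦ skorokhodBdry (X · ω) t := by
  have : (fun ω ↦ skorokhodBdry (X · ω) t) = fun ω ↦ skorokhodBdryDyad (X · ω) t :=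
    funext fun ω ↦ (skorokhodBdryDyad_eq (hc ω) t).symm
  rw [this]
  exact measurable_skorokhodBdryDyad hX t

end Literature.Probability.RandomPlanarGeometry
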